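import Mathlib
import Literature.Analysis.FluidPDE.Tao2016AveragedNS.ShiftSetCascadeFlows
import Literature.Analysis.FluidPDE.Tao2016AveragedNS.ShiftSetCascadeFlux
import Summits.NavierStokesRegularity.NavierStokesRegularity.Theorems.TaoLadderRungTwoFlatCertificateGlueCheckerCoefOn
import Summits.NavierStokesRegularity.NavierStokesRegularity.Theorems.TaoLadderRungTwoFlatCertificateGlueCheckerTableOn
import Summits.NavierStokesRegularity.NavierStokesRegularity.Theorems.TaoLadderRungTwoFlatCertificateGlueFieldBoundsPerCompOn
import HarnessLib

/-!
# Certificate glue on a shift set `𝕊`, XXV-g: THE CHECKER'S INPUT-DEFECT TEST — the per-component input defect `δ` of the window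
  field on the weighted `R`-ball with edge-input bounds `Eb`, `Et` (hypothesis `hdef` of glue XIX-c / XIX-d / XIX-e) from rounded
  dyadic boxes of the off-window monomials (helper for items stmt-NavierStokesRegularity-22987 `FlatGapCertificatesV2` (crux
  K_A♭ of route TaoLadderRungTwoFlat) and stmt-24295 K_A₂(64); cell harvest/h2-tao-ladder, p1 g15; CHECKER-SPEC-v3 §3 (ii) C10)

Glue XV-c `pinputDefectOn_of_table` reduces `PInputDefectOn` (nearest-neighbour `𝕊`) to one inequality per window target `(i,k)`:
`Σ_{(i₁,i₂,μ): a factor off the window} |α| (1+ε₀)^{5(k−μ₃)/2} Ĝ⁺_{i₁}(a) Ĝ⁺_{i₂}(b) ≤ δ·ω i k`, where on the `R`-ball with edge bounds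
`Ĝ⁺ i n = R·ω i n` on the window, `Eb` / `Et` at the edge shells, `0` beyond (`boxSupIn`). For rational data (`α`, `ω`, `ε₀ = q`, `R`,
`Eb`, `Et`) each term divided by `ω i k` lies in `dtermBox` (relative rational enclosure × clock box of glue XXIV-c); `checkDefect`
sums the magnitudes exactly and compares with `δ`; `pinputDefect_of_checkDefect` concludes `hdef`.

HONEST FRAMING: Tao-type MODEL lattices (Tao 2016 §4/§6 vocabulary, shift-set parametrised); arithmetic soundness lemmas — no
certificate data, nothing certified, no stub closed, nothing about the Navier–Stokes equations.
-/

-- the sub-problem namespace repeats the summit name by design (D-0017)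
set_option linter.dupNamespace false

namespace Summit.NavierStokesRegularity.NavierStokesRegularity.Theorems

open Set Finset Literature.Analysis.FluidPDE Literature.Analysis.FluidPDE.TaoCascade
open Summit.NavierStokesRegularity.NavierStokesRegularity.Theorems.TaylorModelCert

namespace CertificateGlueOn

variable {m : ℕ}

/-- The rational edge-extended sup profile `Ĝ⁺ i n / (one factor)`: `R·ωq i n` on the window, `Eb` / `Et` at the edge shells,
`0` beyond. [folklore] -/
def gSupQ (Kb Ka : ℤ) (R Eb Et : ℚ) (ωq : Fin m → ℤ → ℚ) (i : Fin m) (n : ℤ) : ℚ :=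
  if -Kb ≤ n ∧ n ≤ Ka then R * ωq i n else if n = -Kb - 1 then Eb else if n = Ka + 1 then Et else 0

/-- `gSupQ` is the `boxSupIn` of the weighted `R`-ball (`R ≥ 0`, positive weights). [folklore] -/
theorem boxSupIn_pball_eq {Kb Ka : ℤ} {R Eb Et : ℚ} (hR : 0 ≤ R) {ωq : Fin m → ℤ → ℚ} (hω : ∀ i k, 0 < ωq i k)
    (i : Fin m) (n : ℤ) :
    boxSupIn Kb Ka (Eb : ℝ) (Et : ℝ) (fun i k => -((R : ℝ) * (ωq i k : ℝ))) (fun i k => (R : ℝ) * (ωq i k : ℝ)) i n =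
      (gSupQ Kb Ka R Eb Et ωq i n : ℝ) := by
  unfold boxSupIn gSupQ
  by_cases hn : -Kb ≤ n ∧ n ≤ Ka
  · rw [if_pos hn, if_pos hn]
    have h0 : (0 : ℝ) ≤ (R : ℝ) * (ωq i n : ℝ) := by
      have := hω i n; positivity
    rw [abs_neg, abs_of_nonneg h0, max_self]; push_cast; ring
  · rw [if_neg hn, if_neg hn]
    split_ifs <;> push_cast <;> rfl

/-- The box of one off-window monomial of the defect sum at target `(i,k)`, divided by `ω i k` (the zero box if both factors are on
the window). [folklore] -/
def dtermBox (Kb Ka : ℤ) (prec : ℕ) (αq : Fin m → Fin m → Fin m → ℤ × ℤ × ℤ → ℚ) (ωq : Fin m → ℤ → ℚ) (R Eb Et : ℚ)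
    (Sp Sm : IntervalD) (i : Fin m) (k : ℤ) (i₁ i₂ : Fin m) (μ : ℤ × ℤ × ℤ) : IntervalD :=
  if (-Kb ≤ k - μ.2.2 + μ.1 ∧ k - μ.2.2 + μ.1 ≤ Ka) ∧ (-Kb ≤ k - μ.2.2 + μ.2.1 ∧ k - μ.2.2 + μ.2.1 ≤ Ka) then IntervalD.ofInt 0
  else IntervalD.mulR prec
    (ofRatRel prec (|αq i₁ i₂ i μ| * (gSupQ Kb Ka R Eb Et ωq i₁ (k - μ.2.2 + μ.1) * gSupQ Kb Ka R Eb Et ωq i₂ (k - μ.2.2 + μ.2.1)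
      / ωq i k)))
    (clockBox prec Sp Sm (k - μ.2.2))

/-- Exact dyadic sum of the defect-term magnitudes over `(i₁, i₂, μ)` at target `(i, k)`. [folklore] -/
def dRowSum (Kb Ka : ℤ) (prec : ℕ) (shifts : List (ℤ × ℤ × ℤ)) (αq : Fin m → Fin m → Fin m → ℤ × ℤ × ℤ → ℚ)
    (ωq : Fin m → ℤ → ℚ) (R Eb Et : ℚ) (Sp Sm : IntervalD) (i : Fin m) (k : ℤ) : Dyad :=
  (List.finRange m).foldr (fun i₁ acc₁ => Dyad.add ((List.finRange m).foldr (fun i₂ acc₂ => Dyad.add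
    (shifts.foldr (fun μ acc₃ => Dyad.add (IntervalD.mag (dtermBox Kb Ka prec αq ωq R Eb Et Sp Sm i k i₁ i₂ μ)) acc₃)
      (Dyad.ofInt 0)) acc₂) (Dyad.ofInt 0)) acc₁) (Dyad.ofInt 0)

/-- **The defect test**: `dRowSum ≤ δ` at every window target. [folklore] -/
def checkDefect (m : ℕ) (Kb Ka : ℤ) (prec : ℕ) (shifts : List (ℤ × ℤ × ℤ))
    (αq : Fin m → Fin m → Fin m → ℤ × ℤ × ℤ → ℚ) (ωq : Fin m → ℤ → ℚ) (R Eb Et : ℚ) (Sp Sm : IntervalD) (δ : Dyad) : Bool :=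
  (List.finRange m).all fun i => (List.range (winLen Kb Ka)).all fun c =>
    Dyad.ble (dRowSum Kb Ka prec shifts αq ωq R Eb Et Sp Sm i ((c : ℤ) - Kb)) δ

/-- The value of `dRowSum` as a triple sum. [folklore] -/
theorem toReal_dRowSum {Kb Ka : ℤ} {prec : ℕ} {shifts : List (ℤ × ℤ × ℤ)} (hnd : shifts.Nodup)
    {αq : Fin m → Fin m → Fin m → ℤ × ℤ × ℤ → ℚ} {ωq : Fin m → ℤ → ℚ} {R Eb Et : ℚ} {Sp Sm : IntervalD} (i : Fin m) (k : ℤ) :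
    (dRowSum Kb Ka prec shifts αq ωq R Eb Et Sp Sm i k).toReal =
      ∑ i₁ : Fin m, ∑ i₂ : Fin m, ∑ μ ∈ shifts.toFinset,
        (IntervalD.mag (dtermBox Kb Ka prec αq ωq R Eb Et Sp Sm i k i₁ i₂ μ)).toReal := by
  unfold dRowSum
  rw [toReal_foldr_add, Fin.sum_univ_def]
  refine congrArg List.sum (List.map_congr_left fun i₁ _ => ?_)
  rw [toReal_foldr_add, Fin.sum_univ_def]
  refine congrArg List.sum (List.map_congr_left fun i₂ _ => ?_)
  rw [toReal_foldr_add, List.sum_toFinset _ hnd]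

/-- One term of the defect sum is bounded by `ω i k · mag(dtermBox)`. [folklore] -/
theorem dterm_le {Kb Ka : ℤ} (prec : ℕ) {q : ℚ} (hq : 0 < 1 + (q : ℝ)) {αq : Fin m → Fin m → Fin m → ℤ × ℤ × ℤ → ℚ}
    {ωq : Fin m → ℤ → ℚ} (hω : ∀ i k, 0 < ωq i k) {R Eb Et : ℚ} (hR : 0 ≤ R) {Sp Sm : IntervalD}
    (hSp : sqrtCheck prec (1 + q) Sp = true) (hSm : sqrtCheck prec (1 / (1 + q)) Sm = true)
    (i : Fin m) (k : ℤ) (i₁ i₂ : Fin m) (μ : ℤ × ℤ × ℤ) :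
    |(αq i₁ i₂ i μ : ℝ)| * (1 + (q : ℝ)) ^ ((5 : ℝ) * (k - μ.2.2) / 2) *
        (if (-Kb ≤ k - μ.2.2 + μ.1 ∧ k - μ.2.2 + μ.1 ≤ Ka) ∧ (-Kb ≤ k - μ.2.2 + μ.2.1 ∧ k - μ.2.2 + μ.2.1 ≤ Ka) then 0
          else boxSupIn Kb Ka (Eb : ℝ) (Et : ℝ) (fun i k => -((R : ℝ) * (ωq i k : ℝ))) (fun i k => (R : ℝ) * (ωq i k : ℝ)) i₁
              (k - μ.2.2 + μ.1) *
            boxSupIn Kb Ka (Eb : ℝ) (Et : ℝ) (fun i k => -((R : ℝ) * (ωq i k : ℝ))) (fun i k => (R : ℝ) * (ωq i k : ℝ)) i₂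
              (k - μ.2.2 + μ.2.1)) ≤
      (ωq i k : ℝ) * (IntervalD.mag (dtermBox Kb Ka prec αq ωq R Eb Et Sp Sm i k i₁ i₂ μ)).toReal := by
  unfold dtermBox
  by_cases hw : (-Kb ≤ k - μ.2.2 + μ.1 ∧ k - μ.2.2 + μ.1 ≤ Ka) ∧ (-Kb ≤ k - μ.2.2 + μ.2.1 ∧ k - μ.2.2 + μ.2.1 ≤ Ka)
  · have h0 : (IntervalD.mag (IntervalD.ofInt 0)).toReal = 0 := by
      simp [IntervalD.mag, IntervalD.ofInt, IntervalD.ofDyad, Dyad.toReal_max, Dyad.toReal_abs]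
    rw [if_pos hw, if_pos hw, mul_zero, h0, mul_zero]
  · rw [if_neg hw, if_neg hw, boxSupIn_pball_eq hR hω, boxSupIn_pball_eq hR hω]
    have hp : IntervalD.mem (Real.sqrt (1 + (q : ℝ))) Sp := by
      have := mem_sqrt_of_sqrtCheck hSp; push_cast at this; exact this
    have hm : IntervalD.mem (Real.sqrt (1 + (q : ℝ))⁻¹) Sm := by
      have := mem_sqrt_of_sqrtCheck hSm; push_cast at this; rwa [one_div] at this
    have hmem : IntervalD.mem
        (((|αq i₁ i₂ i μ| * (gSupQ Kb Ka R Eb Et ωq i₁ (k - μ.2.2 + μ.1) * gSupQ Kb Ka R Eb Et ωq i₂ (k - μ.2.2 + μ.2.1) /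
            ωq i k) : ℚ) : ℝ) * (1 + (q : ℝ)) ^ ((5 : ℝ) * ((k - μ.2.2 : ℤ) : ℝ) / 2))
        (IntervalD.mulR prec (ofRatRel prec (|αq i₁ i₂ i μ| * (gSupQ Kb Ka R Eb Et ωq i₁ (k - μ.2.2 + μ.1) *
          gSupQ Kb Ka R Eb Et ωq i₂ (k - μ.2.2 + μ.2.1) / ωq i k))) (clockBox prec Sp Sm (k - μ.2.2))) :=
      IntervalD.mem_mulR prec (mem_ofRatRel prec _) (mem_clockBox prec hq hp hm (k - μ.2.2))
    have hle := IntervalD.abs_le_mag hmem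
    have hωk : (0 : ℝ) < (ωq i k : ℝ) := by exact_mod_cast hω i k
    have hval : |(αq i₁ i₂ i μ : ℝ)| * (1 + (q : ℝ)) ^ ((5 : ℝ) * (k - μ.2.2) / 2) *
        ((gSupQ Kb Ka R Eb Et ωq i₁ (k - μ.2.2 + μ.1) : ℝ) * (gSupQ Kb Ka R Eb Et ωq i₂ (k - μ.2.2 + μ.2.1) : ℝ)) =
        (ωq i k : ℝ) * ((((|αq i₁ i₂ i μ| * (gSupQ Kb Ka R Eb Et ωq i₁ (k - μ.2.2 + μ.1) *
          gSupQ Kb Ka R Eb Et ωq i₂ (k - μ.2.2 + μ.2.1) / ωq i k) : ℚ) : ℝ)) *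
          (1 + (q : ℝ)) ^ ((5 : ℝ) * ((k - μ.2.2 : ℤ) : ℝ) / 2)) := by
      push_cast
      field_simp
    rw [hval]
    exact mul_le_mul_of_nonneg_left ((le_abs_self _).trans hle) hωk.le

/-- **`hdef` FROM THE DEFECT TEST**: `checkDefect = true` gives `PInputDefectOn` on the weighted `R`-ball with edge bounds `Eb`, `Et`
(nearest-neighbour `𝕊 = shifts.toFinset`, rational data, `δ := δ.toReal`). [cite: Tao2016AveragedNS, §4 (4.8); cell certificate format, checker clauses] -/
theorem pinputDefect_of_checkDefect {Kb Ka : ℤ} (prec : ℕ) {shifts : List (ℤ × ℤ × ℤ)} (hnd : shifts.Nodup)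
    (h𝕊 : IsNearestNeighbourSet shifts.toFinset) {q : ℚ} (hq : 0 < 1 + (q : ℝ))
    {αq : Fin m → Fin m → Fin m → ℤ × ℤ × ℤ → ℚ} {ωq : Fin m → ℤ → ℚ} (hω : ∀ i k, 0 < ωq i k) {R Eb Et : ℚ} (hR : 0 ≤ R)
    {Sp Sm : IntervalD} (hSp : sqrtCheck prec (1 + q) Sp = true) (hSm : sqrtCheck prec (1 / (1 + q)) Sm = true) {δ : Dyad}
    (h : checkDefect m Kb Ka prec shifts αq ωq R Eb Et Sp Sm δ = true) :
    PInputDefectOn shifts.toFinset (q : ℝ) (fun i₁ i₂ i μ => (αq i₁ i₂ i μ : ℝ)) Kb Ka (Eb : ℝ) (Et : ℝ)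
      (fun i k => (ωq i k : ℝ)) (fun i k => -((R : ℝ) * (ωq i k : ℝ))) (fun i k => (R : ℝ) * (ωq i k : ℝ)) δ.toReal := by
  refine pinputDefectOn_of_table h𝕊 hq fun i k hk1 hk2 => ?_
  simp only [checkDefect, List.all_eq_true, List.mem_finRange, List.mem_range, Dyad.ble_iff, true_implies] at h
  have hc : (k + Kb).toNat < winLen Kb Ka := by
    unfold winLen; rw [Int.toNat_lt_toNat (by omega)]; omega
  have hrow := h i (k + Kb).toNat hc
  rw [Int.toNat_of_nonneg (by omega), show k + Kb - Kb = k by ring, toReal_dRowSum hnd] at hrow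
  have hωk : (0 : ℝ) < (ωq i k : ℝ) := by exact_mod_cast hω i k
  calc _ ≤ ∑ i₁ : Fin m, ∑ i₂ : Fin m, ∑ μ ∈ shifts.toFinset,
          (ωq i k : ℝ) * (IntervalD.mag (dtermBox Kb Ka prec αq ωq R Eb Et Sp Sm i k i₁ i₂ μ)).toReal :=
        Finset.sum_le_sum fun i₁ _ => Finset.sum_le_sum fun i₂ _ => Finset.sum_le_sum fun μ _ => by
          simpa [Rat.cast_abs] using dterm_le prec hq hω hR hSp hSm i k i₁ i₂ μ
    _ = (ωq i k : ℝ) * ∑ i₁ : Fin m, ∑ i₂ : Fin m, ∑ μ ∈ shifts.toFinset,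
          (IntervalD.mag (dtermBox Kb Ka prec αq ωq R Eb Et Sp Sm i k i₁ i₂ μ)).toReal := by simp only [Finset.mul_sum]
    _ ≤ (ωq i k : ℝ) * δ.toReal := mul_le_mul_of_nonneg_left hrow hωk.le
    _ = δ.toReal * (ωq i k : ℝ) := mul_comm _ _

end CertificateGlueOn

end Summit.NavierStokesRegularity.NavierStokesRegularity.Theorems
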